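import Mathlib
import HarnessLib
import Summits.NavierStokesRegularity.FluidComputer.BurgersTubeHeredity
import Summits.NavierStokesRegularity.FluidComputer.BurgersTubeStrainSharp

/-!
# The planar Lamb–Oseen strain field: one Gaussian core, a co-rotating pair, a counter-rotating pair
# (instab lane, door O-acc = O7, obstruction P3 — the kinematics behind `HEREDITY-P3.md` (B))

HONEST FRAMING (cell `ns-blowup`, seat `ns-blowup-instab2`; human ruling D-0035): nothing here is a
claim about Navier–Stokes blow-up. WHAT THIS IS NOT: not dynamics of any real flow; it is the
two-variable calculus that LINKS the velocity field of a Gaussian (Lamb–Oseen / Burgers) vortex core to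
the normalised strain function `s(x) = (1 − (1 + x²) e^{−x²}) / (2x²)` whose bounds are already kernel
(`BurgersTubeHeredity.oseenStrain_le`, `BurgersTubeStrainSharp.oseenStrain_le_sharp : s ≤ 3/20`). Until
now the sentence «the in-plane rate-of-strain eigenvalue of a Gaussian core of peak vorticity `ω₀` at
radius `r` is `ω₀ · s(r/a)`» and the PAIR statements of `HEREDITY-P3.md` (B) («co-rotating pair: the
midpoint is a stagnation point where the two strain tensors are equal and ADD, strain `2ω₀ s(D/2a)`;
counter-rotating pair: `∇u` CANCELS at the midpoint») were paper-grade; this file makes them kernel.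

## The field (written through universally quantified `F`, `u₁`, `u₂` pinned by hypotheses — no definitions)

* core factor `F(s) = (1 − e^{−s/a²})/s` (`s = r²`; core radius `a ≠ 0`), so that the planar
  Lamb–Oseen velocity of circulation `Γ` centred at the origin is
  `u₁(x,y) = −(Γ/2π) · y · F(x²+y²)`, `u₂(x,y) = (Γ/2π) · x · F(x²+y²)`
  (azimuthal speed `u_θ = (Γ/2πr)(1 − e^{−r²/a²})`, vorticity `ω = ω₀ e^{−r²/a²}`, `ω₀ = Γ/(πa²)`);
* evaluation point `(d, 0)`, `d ≠ 0` (by rotational symmetry this is every point at radius `|d|`);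
  the four partial derivatives there are `∂ₓu₁ = 0`, `∂_y u₁ = −(Γ/2π) F(d²)`,
  `∂ₓu₂ = (Γ/2π)(F(d²) + 2d² F′(d²))`, `∂_y u₂ = 0` (§1), hence the rate-of-strain tensor is
  `S = [[0, S₁₂],[S₁₂, 0]]` with `S₁₂ = (Γ/2π) d² F′(d²) = −ω₀ · s(d/a)` and principal strains `±S₁₂`
  along the diagonals, `|S₁₂| ≤ (3/20)|ω₀|`; and `∂ₓu₂ − ∂_y u₁ = ω₀ e^{−d²/a²}` (the Gaussian
  vorticity, a consistency check of the field);
* §2 co-rotating pair (equal `Γ`, `a`; centres `(∓d, 0)`, separation `D = 2d`): `v = u(·+d,·) + u(·−d,·)`;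
  the midpoint is a stagnation point, every partial derivative there is TWICE the single-core value at
  distance `d`, so the strain is `2ω₀ s(d/a) = 2ω₀ s(D/2a)`, `≤ (3/10)|ω₀|`;
* §3 counter-rotating pair `w = u(·+d,·) − u(·−d,·)`: all four partial derivatives vanish at the
  midpoint (locally a pure translation with speed `(Γ/πd)(1 − e^{−d²/a²}) ≠ 0`).

Mathlib + the two kernel files above. LABEL: MODEL/kinematic bookkeeping; the fluid reading (heredity's
strain constant `θ ≤ 0.15` per tube, `≤ 0.30` per co-rotating pair, located OFF the cores) is in the memo.
-/

namespace Summit.NavierStokesRegularity.FluidComputer.LambOseenStrainField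

section CoreFactor

/-! ## §0 The core factor `F(s) = (1 − e^{−s/a²})/s` and its derivative -/

/-- `F′(s) = (e^{−s/a²} s/a² − (1 − e^{−s/a²})) / s²` for `s ≠ 0`. -/
theorem hasDerivAt_coreFactor (a : ℝ) {s : ℝ} (hs : s ≠ 0) :
    HasDerivAt (fun s => (1 - Real.exp (-s / a ^ 2)) / s)
      ((Real.exp (-s / a ^ 2) / a ^ 2 * s - (1 - Real.exp (-s / a ^ 2))) / s ^ 2) s := by
  have h1 : HasDerivAt (fun s => -s / a ^ 2) (-1 / a ^ 2) s := by
    have := ((hasDerivAt_id' s).neg).div_const (a ^ 2)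
    simpa [neg_div] using this
  have h2 : HasDerivAt (fun s => Real.exp (-s / a ^ 2)) (Real.exp (-s / a ^ 2) * (-1 / a ^ 2)) s :=
    (Real.hasDerivAt_exp _).comp s h1
  have h3 : HasDerivAt (fun s => 1 - Real.exp (-s / a ^ 2)) (-(Real.exp (-s / a ^ 2) * (-1 / a ^ 2))) s :=
    h2.const_sub 1
  have h4 := h3.div (hasDerivAt_id' s) hs
  refine h4.congr_deriv ?_
  field_simp

end CoreFactor

section OneCore

/-! ## §1 One Gaussian core at the origin, evaluated at `(d, 0)` -/

variable {Γ a d : ℝ} {F : ℝ → ℝ} {u₁ u₂ : ℝ → ℝ → ℝ}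

/-- `∂ₓ u₁ (d,0) = 0`: along the `x`-axis `u₁(x, 0) ≡ 0`. -/
theorem hasDerivAt_u1_dx (hu₁ : ∀ x y, u₁ x y = -(Γ / (2 * Real.pi)) * y * F (x ^ 2 + y ^ 2)) (d : ℝ) :
    HasDerivAt (fun x => u₁ x 0) 0 d := by
  have h : (fun x => u₁ x 0) = fun _ => (0 : ℝ) := by
    funext x; rw [hu₁]; ring
  rw [h]
  exact hasDerivAt_const d 0

/-- `∂_y u₁ (d,0) = −(Γ/2π) F(d²)` (`d ≠ 0`). -/
theorem hasDerivAt_u1_dy (hF : ∀ s, F s = (1 - Real.exp (-s / a ^ 2)) / s)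
    (hu₁ : ∀ x y, u₁ x y = -(Γ / (2 * Real.pi)) * y * F (x ^ 2 + y ^ 2)) (hd : d ≠ 0) :
    HasDerivAt (fun y => u₁ d y) (-(Γ / (2 * Real.pi)) * F (d ^ 2)) 0 := by
  have hF' : F = fun s => (1 - Real.exp (-s / a ^ 2)) / s := funext hF
  have h : (fun y => u₁ d y) = fun y => (-(Γ / (2 * Real.pi)) * y) * F (d ^ 2 + y ^ 2) := by
    funext y; rw [hu₁]
  rw [h]
  subst hF'
  have hs : d ^ 2 + (0 : ℝ) ^ 2 ≠ 0 := by simpa using pow_ne_zero 2 hd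
  have hg : HasDerivAt (fun y : ℝ => d ^ 2 + y ^ 2) (0 : ℝ) 0 := by
    have := ((hasDerivAt_pow 2 (0 : ℝ)).const_add (d ^ 2))
    simpa using this
  have hFg := HasDerivAt.comp (h := fun y : ℝ => d ^ 2 + y ^ 2) 0 (hasDerivAt_coreFactor a hs) hg
  have hlin : HasDerivAt (fun y : ℝ => -(Γ / (2 * Real.pi)) * y) (-(Γ / (2 * Real.pi)) * 1) 0 :=
    (hasDerivAt_id' (0 : ℝ)).const_mul _
  have := hlin.mul hFg
  refine this.congr_deriv ?_
  simp [Function.comp]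

/-- `∂ₓ u₂ (d,0) = (Γ/2π) (F(d²) + 2d² F′(d²))` with `F′` written out (`d ≠ 0`). -/
theorem hasDerivAt_u2_dx (hF : ∀ s, F s = (1 - Real.exp (-s / a ^ 2)) / s)
    (hu₂ : ∀ x y, u₂ x y = (Γ / (2 * Real.pi)) * x * F (x ^ 2 + y ^ 2)) (hd : d ≠ 0) :
    HasDerivAt (fun x => u₂ x 0)
      ((Γ / (2 * Real.pi)) * (F (d ^ 2) + 2 * d ^ 2 *
        ((Real.exp (-d ^ 2 / a ^ 2) / a ^ 2 * d ^ 2 - (1 - Real.exp (-d ^ 2 / a ^ 2))) / (d ^ 2) ^ 2))) d := by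
  have hF' : F = fun s => (1 - Real.exp (-s / a ^ 2)) / s := funext hF
  have h : (fun x => u₂ x 0) = fun x => (Γ / (2 * Real.pi)) * (x * F (x ^ 2)) := by
    funext x; rw [hu₂, zero_pow two_ne_zero, add_zero]; ring
  rw [h]
  subst hF'
  have hs : d ^ 2 ≠ 0 := pow_ne_zero 2 hd
  have hg : HasDerivAt (fun x : ℝ => x ^ 2) (2 * d) d := by
    have := hasDerivAt_pow 2 d
    simpa using this
  have hFg := HasDerivAt.comp (h := fun x : ℝ => x ^ 2) d (hasDerivAt_coreFactor a hs) hg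
  have := ((hasDerivAt_id' d).mul hFg).const_mul (Γ / (2 * Real.pi))
  refine this.congr_deriv ?_
  simp only [Function.comp]
  ring

/-- `∂_y u₂ (d,0) = 0` (`d ≠ 0`). -/
theorem hasDerivAt_u2_dy (hF : ∀ s, F s = (1 - Real.exp (-s / a ^ 2)) / s)
    (hu₂ : ∀ x y, u₂ x y = (Γ / (2 * Real.pi)) * x * F (x ^ 2 + y ^ 2)) (hd : d ≠ 0) :
    HasDerivAt (fun y => u₂ d y) 0 0 := by
  have hF' : F = fun s => (1 - Real.exp (-s / a ^ 2)) / s := funext hF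
  have h : (fun y => u₂ d y) = fun y => (Γ / (2 * Real.pi)) * d * F (d ^ 2 + y ^ 2) := by
    funext y; rw [hu₂]
  rw [h]
  subst hF'
  have hs : d ^ 2 + (0 : ℝ) ^ 2 ≠ 0 := by simpa using pow_ne_zero 2 hd
  have hg : HasDerivAt (fun y : ℝ => d ^ 2 + y ^ 2) (0 : ℝ) 0 := by
    have := ((hasDerivAt_pow 2 (0 : ℝ)).const_add (d ^ 2))
    simpa using this
  have hFg := HasDerivAt.comp (h := fun y : ℝ => d ^ 2 + y ^ 2) 0 (hasDerivAt_coreFactor a hs) hg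
  have := hFg.const_mul ((Γ / (2 * Real.pi)) * d)
  refine this.congr_deriv ?_
  simp

/-- VORTICITY CHECK: `∂ₓu₂ − ∂_y u₁ = ω₀ e^{−d²/a²}` at `(d,0)`, `ω₀ = Γ/(πa²)` — the field IS the
Gaussian core. (Pure algebra on the two derivative values of `hasDerivAt_u2_dx`, `hasDerivAt_u1_dy`.) -/
theorem vorticity_eq (hF : ∀ s, F s = (1 - Real.exp (-s / a ^ 2)) / s) (ha : a ≠ 0) (hd : d ≠ 0) :
    (Γ / (2 * Real.pi)) * (F (d ^ 2) + 2 * d ^ 2 *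
        ((Real.exp (-d ^ 2 / a ^ 2) / a ^ 2 * d ^ 2 - (1 - Real.exp (-d ^ 2 / a ^ 2))) / (d ^ 2) ^ 2))
      - (-(Γ / (2 * Real.pi)) * F (d ^ 2)) = Γ / (Real.pi * a ^ 2) * Real.exp (-d ^ 2 / a ^ 2) := by
  rw [hF]
  have hs : d ^ 2 ≠ 0 := pow_ne_zero 2 hd
  have ha2 : a ^ 2 ≠ 0 := pow_ne_zero 2 ha
  field_simp
  ring

/-- STRAIN = `−ω₀ · s(d/a)`: the off-diagonal rate of strain `S₁₂ = ½(∂_y u₁ + ∂ₓ u₂)` at `(d,0)` equals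
`−(Γ/(πa²)) · (1 − (1 + (d/a)²) e^{−(d/a)²}) / (2 (d/a)²)` — the normalised strain function of
`BurgersTubeHeredity` / `BurgersTubeStrainSharp` evaluated at `x = d/a`, times the peak vorticity. -/
theorem strain_offdiag_eq (hF : ∀ s, F s = (1 - Real.exp (-s / a ^ 2)) / s) (ha : a ≠ 0) (hd : d ≠ 0) :
    (1 / 2 : ℝ) * ((-(Γ / (2 * Real.pi)) * F (d ^ 2)) + (Γ / (2 * Real.pi)) * (F (d ^ 2) + 2 * d ^ 2 *
        ((Real.exp (-d ^ 2 / a ^ 2) / a ^ 2 * d ^ 2 - (1 - Real.exp (-d ^ 2 / a ^ 2))) / (d ^ 2) ^ 2)))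
      = -(Γ / (Real.pi * a ^ 2)) * ((1 - (1 + (d / a) ^ 2) * Real.exp (-(d / a) ^ 2)) / (2 * (d / a) ^ 2)) := by
  rw [hF]
  have hs : d ^ 2 ≠ 0 := pow_ne_zero 2 hd
  have ha2 : a ^ 2 ≠ 0 := pow_ne_zero 2 ha
  have he : Real.exp (-(d / a) ^ 2) = Real.exp (-d ^ 2 / a ^ 2) := by
    congr 1
    rw [div_pow]
    ring
  rw [he, div_pow]
  field_simp
  ring

/-- PRINCIPAL STRAINS: the symmetric tensor `!![0, S; S, 0]` stretches the diagonal `(1,1)` at rate `S`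
and the anti-diagonal `(1,−1)` at rate `−S` — eigenvalues `±S`, so the in-plane strain eigenvalue of
the core at radius `|d|` is `|S₁₂| = |ω₀| · s(d/a)`. -/
theorem strain_principal_axes (S : ℝ) :
    (!![0, S; S, 0] : Matrix (Fin 2) (Fin 2) ℝ).mulVec ![1, 1] = S • ![1, 1] ∧
      (!![0, S; S, 0] : Matrix (Fin 2) (Fin 2) ℝ).mulVec ![1, -1] = (-S) • ![1, -1] := by
  constructor
  · ext i
    fin_cases i <;> simp [Matrix.mulVec, dotProduct, Fin.sum_univ_two]
  · ext i
    fin_cases i <;> simp [Matrix.mulVec, dotProduct, Fin.sum_univ_two]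

/-- ONE-TUBE STRAIN CONSTANT, field form: `|S₁₂| ≤ (3/20) · |ω₀|` at every point off the axis —
`BurgersTubeStrainSharp.oseenStrain_le_sharp` transported to the velocity field. -/
theorem strain_offdiag_abs_le (Γ a d : ℝ) :
    |-(Γ / (Real.pi * a ^ 2)) * ((1 - (1 + (d / a) ^ 2) * Real.exp (-(d / a) ^ 2)) / (2 * (d / a) ^ 2))|
      ≤ 3 / 20 * |Γ / (Real.pi * a ^ 2)| := by
  have h0 := BurgersTubeHeredity.oseenStrain_nonneg (d / a)
  have h1 := BurgersTubeStrainSharp.oseenStrain_le_sharp (d / a)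
  rw [abs_mul, abs_neg, abs_of_nonneg h0]
  have := abs_nonneg (Γ / (Real.pi * a ^ 2))
  nlinarith

end OneCore

section CoRotatingPair

/-! ## §2 Two EQUAL co-rotating cores (centres `(∓d, 0)`, separation `D = 2d`): the midpoint -/

variable {Γ a d : ℝ} {F : ℝ → ℝ} {u₁ u₂ v₁ v₂ : ℝ → ℝ → ℝ}

/-- The midpoint of a co-rotating equal pair is a STAGNATION POINT: `v(0,0) = 0`. -/
theorem pair_midpoint_stagnation
    (hu₁ : ∀ x y, u₁ x y = -(Γ / (2 * Real.pi)) * y * F (x ^ 2 + y ^ 2))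
    (hu₂ : ∀ x y, u₂ x y = (Γ / (2 * Real.pi)) * x * F (x ^ 2 + y ^ 2))
    (hv₁ : ∀ x y, v₁ x y = u₁ (x + d) y + u₁ (x - d) y)
    (hv₂ : ∀ x y, v₂ x y = u₂ (x + d) y + u₂ (x - d) y) :
    v₁ 0 0 = 0 ∧ v₂ 0 0 = 0 := by
  constructor
  · rw [hv₁, hu₁, hu₁]; ring
  · rw [hv₂, hu₂, hu₂, zero_add, zero_sub, neg_sq]; ring

/-- `∂ₓ v₁ (0,0) = 0` (`v₁(x,0) ≡ 0`). -/
theorem pair_hasDerivAt_v1_dx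
    (hu₁ : ∀ x y, u₁ x y = -(Γ / (2 * Real.pi)) * y * F (x ^ 2 + y ^ 2))
    (hv₁ : ∀ x y, v₁ x y = u₁ (x + d) y + u₁ (x - d) y) :
    HasDerivAt (fun x => v₁ x 0) 0 0 := by
  have h : (fun x => v₁ x 0) = fun _ => (0 : ℝ) := by
    funext x; rw [hv₁, hu₁, hu₁]; ring
  rw [h]
  exact hasDerivAt_const 0 0

/-- `∂_y v₁ (0,0) = −(Γ/π) F(d²)` — TWICE the single-core value at distance `d`. -/
theorem pair_hasDerivAt_v1_dy (hF : ∀ s, F s = (1 - Real.exp (-s / a ^ 2)) / s)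
    (hu₁ : ∀ x y, u₁ x y = -(Γ / (2 * Real.pi)) * y * F (x ^ 2 + y ^ 2))
    (hv₁ : ∀ x y, v₁ x y = u₁ (x + d) y + u₁ (x - d) y) (hd : d ≠ 0) :
    HasDerivAt (fun y => v₁ 0 y) (-(Γ / Real.pi) * F (d ^ 2)) 0 := by
  have h : (fun y => v₁ 0 y) = fun y => u₁ d y + u₁ (-d) y := by
    funext y; rw [hv₁, zero_add, zero_sub]
  rw [h]
  have h1 := hasDerivAt_u1_dy hF hu₁ hd
  have h2 := hasDerivAt_u1_dy (d := -d) hF hu₁ (neg_ne_zero.mpr hd)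
  refine (h1.add h2).congr_deriv ?_
  rw [neg_sq]
  ring

/-- `∂ₓ v₂ (0,0) = (Γ/π)(F(d²) + 2d² F′(d²))` — TWICE the single-core value (the second core sits at
`−d` and `(−d)² = d²`: the two velocity-gradient tensors at the midpoint are EQUAL and add). -/
theorem pair_hasDerivAt_v2_dx (hF : ∀ s, F s = (1 - Real.exp (-s / a ^ 2)) / s)
    (hu₂ : ∀ x y, u₂ x y = (Γ / (2 * Real.pi)) * x * F (x ^ 2 + y ^ 2))
    (hv₂ : ∀ x y, v₂ x y = u₂ (x + d) y + u₂ (x - d) y) (hd : d ≠ 0) :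
    HasDerivAt (fun x => v₂ x 0)
      ((Γ / Real.pi) * (F (d ^ 2) + 2 * d ^ 2 *
        ((Real.exp (-d ^ 2 / a ^ 2) / a ^ 2 * d ^ 2 - (1 - Real.exp (-d ^ 2 / a ^ 2))) / (d ^ 2) ^ 2))) 0 := by
  have h : (fun x => v₂ x 0) = fun x => u₂ (x + d) 0 + u₂ (x - d) 0 := by
    funext x; rw [hv₂]
  rw [h]
  have hd1 : (0 : ℝ) + d ≠ 0 := by rwa [zero_add]
  have hd2 : (0 : ℝ) - d ≠ 0 := by rwa [zero_sub, neg_ne_zero]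
  have h1 := (hasDerivAt_u2_dx (d := 0 + d) hF hu₂ hd1).comp_add_const 0 d
  have h2 := (hasDerivAt_u2_dx (d := 0 - d) hF hu₂ hd2).comp_sub_const 0 d
  refine (h1.add h2).congr_deriv ?_
  simp only [zero_add, zero_sub, neg_sq]
  ring

/-- `∂_y v₂ (0,0) = 0` (`v₂(0,y) ≡ 0` by the symmetry `x ↦ −x`). -/
theorem pair_hasDerivAt_v2_dy
    (hu₂ : ∀ x y, u₂ x y = (Γ / (2 * Real.pi)) * x * F (x ^ 2 + y ^ 2))
    (hv₂ : ∀ x y, v₂ x y = u₂ (x + d) y + u₂ (x - d) y) :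
    HasDerivAt (fun y => v₂ 0 y) 0 0 := by
  have h : (fun y => v₂ 0 y) = fun _ => (0 : ℝ) := by
    funext y; rw [hv₂, hu₂, hu₂, zero_add, zero_sub, neg_sq]; ring
  rw [h]
  exact hasDerivAt_const 0 0

/-- PAIR STRAIN = `−2ω₀ · s(d/a) = −2ω₀ · s(D/2a)`: the off-diagonal rate of strain
`½(∂_y v₁ + ∂ₓ v₂)` at the midpoint is exactly twice the one-core value at distance `d = D/2`
(HEREDITY-P3 (B): `0.264 / 0.296 / 0.292 / 0.227 ω₀` at `D = 2 / 2.5 / 3 / 4 a`). -/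
theorem pair_strain_offdiag_eq (hF : ∀ s, F s = (1 - Real.exp (-s / a ^ 2)) / s) (ha : a ≠ 0) (hd : d ≠ 0) :
    (1 / 2 : ℝ) * ((-(Γ / Real.pi) * F (d ^ 2)) + (Γ / Real.pi) * (F (d ^ 2) + 2 * d ^ 2 *
        ((Real.exp (-d ^ 2 / a ^ 2) / a ^ 2 * d ^ 2 - (1 - Real.exp (-d ^ 2 / a ^ 2))) / (d ^ 2) ^ 2)))
      = -2 * (Γ / (Real.pi * a ^ 2)) * ((1 - (1 + (d / a) ^ 2) * Real.exp (-(d / a) ^ 2)) / (2 * (d / a) ^ 2)) := by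
  have h := strain_offdiag_eq (Γ := Γ) hF ha hd
  linear_combination 2 * h

/-- PAIR STRAIN CONSTANT, field form: `|S₁₂(pair)| ≤ (3/10) · |ω₀|`
(`BurgersTubeStrainSharp.two_oseenStrain_le_sharp` transported to the pair's midpoint). -/
theorem pair_strain_offdiag_abs_le (Γ a d : ℝ) :
    |-2 * (Γ / (Real.pi * a ^ 2)) * ((1 - (1 + (d / a) ^ 2) * Real.exp (-(d / a) ^ 2)) / (2 * (d / a) ^ 2))|
      ≤ 3 / 10 * |Γ / (Real.pi * a ^ 2)| := by
  have h0 := BurgersTubeHeredity.oseenStrain_nonneg (d / a)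
  have h1 := BurgersTubeStrainSharp.oseenStrain_le_sharp (d / a)
  rw [abs_mul, abs_mul, abs_neg, abs_of_nonneg h0]
  have := abs_nonneg (Γ / (Real.pi * a ^ 2))
  norm_num
  nlinarith

end CoRotatingPair

section CounterRotatingPair

/-! ## §3 Counter-rotating equal pair (`Γ` at `(−d,0)`, `−Γ` at `(d,0)`): the midpoint gradient CANCELS -/

variable {Γ a d : ℝ} {F : ℝ → ℝ} {u₁ u₂ w₁ w₂ : ℝ → ℝ → ℝ}

/-- `∂ₓ w₁ (0,0) = 0`. -/
theorem dipole_hasDerivAt_w1_dx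
    (hu₁ : ∀ x y, u₁ x y = -(Γ / (2 * Real.pi)) * y * F (x ^ 2 + y ^ 2))
    (hw₁ : ∀ x y, w₁ x y = u₁ (x + d) y - u₁ (x - d) y) :
    HasDerivAt (fun x => w₁ x 0) 0 0 := by
  have h : (fun x => w₁ x 0) = fun _ => (0 : ℝ) := by
    funext x; rw [hw₁, hu₁, hu₁]; ring
  rw [h]
  exact hasDerivAt_const 0 0

/-- `∂_y w₁ (0,0) = 0` (`w₁(0,y) ≡ 0`: the two contributions `∓(Γ/2π) y F(d²+y²)` cancel identically). -/
theorem dipole_hasDerivAt_w1_dy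
    (hu₁ : ∀ x y, u₁ x y = -(Γ / (2 * Real.pi)) * y * F (x ^ 2 + y ^ 2))
    (hw₁ : ∀ x y, w₁ x y = u₁ (x + d) y - u₁ (x - d) y) :
    HasDerivAt (fun y => w₁ 0 y) 0 0 := by
  have h : (fun y => w₁ 0 y) = fun _ => (0 : ℝ) := by
    funext y; rw [hw₁, hu₁, hu₁, zero_add, zero_sub, neg_sq]; ring
  rw [h]
  exact hasDerivAt_const 0 0

/-- `∂ₓ w₂ (0,0) = 0`: the two single-core values `(Γ/2π)(F(d²) + 2d²F′(d²))` are equal and SUBTRACT. -/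
theorem dipole_hasDerivAt_w2_dx (hF : ∀ s, F s = (1 - Real.exp (-s / a ^ 2)) / s)
    (hu₂ : ∀ x y, u₂ x y = (Γ / (2 * Real.pi)) * x * F (x ^ 2 + y ^ 2))
    (hw₂ : ∀ x y, w₂ x y = u₂ (x + d) y - u₂ (x - d) y) (hd : d ≠ 0) :
    HasDerivAt (fun x => w₂ x 0) 0 0 := by
  have h : (fun x => w₂ x 0) = fun x => u₂ (x + d) 0 - u₂ (x - d) 0 := by
    funext x; rw [hw₂]
  rw [h]
  have hd1 : (0 : ℝ) + d ≠ 0 := by rwa [zero_add]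
  have hd2 : (0 : ℝ) - d ≠ 0 := by rwa [zero_sub, neg_ne_zero]
  have h1 := (hasDerivAt_u2_dx (d := 0 + d) hF hu₂ hd1).comp_add_const 0 d
  have h2 := (hasDerivAt_u2_dx (d := 0 - d) hF hu₂ hd2).comp_sub_const 0 d
  refine (h1.sub h2).congr_deriv ?_
  simp only [zero_add, zero_sub, neg_sq]
  ring

/-- `∂_y w₂ (0,0) = 0`: `w₂(0,y) = (Γ/π) d F(d²+y²)` is even in `y`. -/
theorem dipole_hasDerivAt_w2_dy (hF : ∀ s, F s = (1 - Real.exp (-s / a ^ 2)) / s)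
    (hu₂ : ∀ x y, u₂ x y = (Γ / (2 * Real.pi)) * x * F (x ^ 2 + y ^ 2))
    (hw₂ : ∀ x y, w₂ x y = u₂ (x + d) y - u₂ (x - d) y) (hd : d ≠ 0) :
    HasDerivAt (fun y => w₂ 0 y) 0 0 := by
  have hF' : F = fun s => (1 - Real.exp (-s / a ^ 2)) / s := funext hF
  have h : (fun y => w₂ 0 y) = fun y => (Γ / Real.pi * d) * F (d ^ 2 + y ^ 2) := by
    funext y; rw [hw₂, hu₂, hu₂, zero_add, zero_sub, neg_sq]; ring
  rw [h]
  subst hF'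
  have hs : d ^ 2 + (0 : ℝ) ^ 2 ≠ 0 := by simpa using pow_ne_zero 2 hd
  have hg : HasDerivAt (fun y : ℝ => d ^ 2 + y ^ 2) (0 : ℝ) 0 := by
    have := ((hasDerivAt_pow 2 (0 : ℝ)).const_add (d ^ 2))
    simpa using this
  have hFg := HasDerivAt.comp (h := fun y : ℝ => d ^ 2 + y ^ 2) 0 (hasDerivAt_coreFactor a hs) hg
  have := hFg.const_mul (Γ / Real.pi * d)
  refine this.congr_deriv ?_
  simp

/-- … yet the midpoint is NOT a stagnation point: `w(0,0) = (0, (Γ/πd)(1 − e^{−d²/a²}))`, the mutual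
induction that translates the pair (locally a pure translation: zero strain AND zero rotation). -/
theorem dipole_midpoint_velocity (hF : ∀ s, F s = (1 - Real.exp (-s / a ^ 2)) / s)
    (hu₁ : ∀ x y, u₁ x y = -(Γ / (2 * Real.pi)) * y * F (x ^ 2 + y ^ 2))
    (hu₂ : ∀ x y, u₂ x y = (Γ / (2 * Real.pi)) * x * F (x ^ 2 + y ^ 2))
    (hw₁ : ∀ x y, w₁ x y = u₁ (x + d) y - u₁ (x - d) y)
    (hw₂ : ∀ x y, w₂ x y = u₂ (x + d) y - u₂ (x - d) y) (hd : d ≠ 0) :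
    w₁ 0 0 = 0 ∧ w₂ 0 0 = Γ / (Real.pi * d) * (1 - Real.exp (-d ^ 2 / a ^ 2)) := by
  constructor
  · rw [hw₁, hu₁, hu₁]; ring
  · rw [hw₂, hu₂, hu₂, zero_add, zero_sub, neg_sq, zero_pow two_ne_zero, add_zero, hF]
    have hs : d ^ 2 ≠ 0 := pow_ne_zero 2 hd
    field_simp
    ring

/-- The translation speed is nonzero for `Γ ≠ 0`, `a ≠ 0`, `d ≠ 0` (`e^{−d²/a²} < 1`). -/
theorem dipole_midpoint_speed_ne_zero (hΓ : Γ ≠ 0) (ha : a ≠ 0) (hd : d ≠ 0) :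
    Γ / (Real.pi * d) * (1 - Real.exp (-d ^ 2 / a ^ 2)) ≠ 0 := by
  have hda : 0 < d ^ 2 / a ^ 2 := by positivity
  have hlt : Real.exp (-d ^ 2 / a ^ 2) < 1 := by
    rw [Real.exp_lt_one_iff, neg_div]
    linarith
  have h1 : 1 - Real.exp (-d ^ 2 / a ^ 2) ≠ 0 := by linarith
  have h2 : Γ / (Real.pi * d) ≠ 0 := div_ne_zero hΓ (mul_ne_zero Real.pi_ne_zero hd)
  exact mul_ne_zero h2 h1

end CounterRotatingPair

end Summit.NavierStokesRegularity.FluidComputer.LambOseenStrainField
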